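import Summits.AnomalousDissipation.AnomalousDissipation.Theorems.ImpulseGridMeanMomentumBalance
import Literature.Analysis.FluidPDE.CylindricalTrajectory
import Literature.Analysis.FluidPDE.TimeAverageMeasureBasic
import Literature.Analysis.FunctionSpaces.TorusChainRule

/-!
# Route ImpulseGrid (AnomalousDissipation) — the grid injection identity

Settles item `stmt-AnomalousDissipation-1774`: the route's support statement
`Summit.AnomalousDissipation.AnomalousDissipation.Theses.ImpulseGrid.GridInjectionIdentity`
(`impulseGrid_gridInjectionIdentity`). For the slab⊗transverse force `Φ•G` (`G` smooth,
`G₀ ≡ 0`, `x₀`-invariant, divergence free; `Ψ` smooth, `x₁,x₂`-invariant, `∂₀Ψ = Φ − 1`), any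
constant `c`, `w := u − c e₀`, and a global Leray–Hopf solution with bounded kinetic energy:

1. `c·Λ⟨(Φ•G,u)⟩ = c·Λ⟨(G,u)⟩ − Λ⟨∫⟪w,(w·∇)(Ψ•G)⟫⟩ − νΛ⟨(u,Δ(Ψ•G))⟩ − ∫ΦΨ|G|²`;
2. `Λ⟨∫⟪w,(w·∇)G⟫⟩ = −∫Φ|G|² − νΛ⟨(u,ΔG)⟩`.

Both are the mean momentum balance (`meanMomentumBalance_proof`, item stmt-AnomalousDissipation-1773,
file `ImpulseGridMeanMomentumBalance`) tested with `Ψ•G` resp. `G` (both divergence free), after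
the pointwise algebra `⟪u,(u·∇)V⟫ = ⟪w,(w·∇)V⟫ + c⟪u,∂₀V⟫` for `V₀ ≡ 0` (the `e₀`-components of
`(w·∇)V` and `∂₀V` vanish), `∂₀(Ψ•G) = (Φ−1)•G`, `∂₀G = 0`, `⟪Φ•G,Ψ•G⟫ = ΦΨ|G|²`, and linearity
of `Λ⟨·⟩ = Λ ∘ timeMean` on pieces that are interval integrable on every `[0, T]` (the
`Torus.trajFlux` bookkeeping of `CylindricalTrajectory` / `LerayHopfTimeSliceTorus`). No Fubini or
slicing in `x₀` is used.

References: Foias–Manley–Rosa–Temam 2001, Ch. IV §3.1; Doering–Foias 2002 §2 (bookkeeping of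
body-forced Navier–Stokes in generalized limits).
-/

noncomputable section

-- `Summit.<Summit>.<Problem>` is the tree's mandated summit-side namespace (CONVENTIONS §2); for this
-- single-conjunct summit the two coincide, so the duplicate is deliberate.
set_option linter.dupNamespace false

open MeasureTheory Set Filter Topology
open scoped InnerProductSpace RealInnerProductSpace

namespace Summit.AnomalousDissipation.AnomalousDissipation.Theorems

open Literature.Analysis.FluidPDE Literature.Analysis.FluidPDE.Torus
open Literature.Analysis.FunctionSpaces Literature.Analysis.FunctionSpaces.Torus

namespace GridInjection

variable {d : Type*} [Fintype d] [DecidableEq d]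

/-! ### Interval integrability of the pairings along a global Leray–Hopf solution -/

section Pairing

variable {ν : ℝ} {F u₀ : UnitAddTorus d → EuclideanSpace ℝ d}
  {u : ℝ → UnitAddTorus d → EuclideanSpace ℝ d}

/-- On a square-integrable slice the flux splits into its three spatial integrals. [folklore] -/
theorem trajFlux_eq_of_memLp {g : UnitAddTorus d → EuclideanSpace ℝ d} (hg : IsSmooth g)
    (hF : MemLp F 2 volume) {t : ℝ} (hmem : MemLp (u t) 2 volume) :
    trajFlux ν F u g t = (∫ x, ⟪u t x, convect (u t) g x⟫) +
      ν * (∫ x, ⟪u t x, laplacian g x⟫) + ∫ x, ⟪F x, g x⟫ := by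
  have i1 := integrable_inner_convect_self hmem hg
  have i2 : Integrable (fun x => ⟪u t x, laplacian g x⟫) volume :=
    integrable_inner_of_continuous (hmem.integrable one_le_two) hg.laplacian.continuous
  have i3 : Integrable (fun x => ⟪F x, g x⟫) volume :=
    integrable_inner_of_continuous (hF.integrable one_le_two) hg.continuous
  have i12 : Integrable (fun x => ⟪u t x, convect (u t) g x⟫ + ν * ⟪u t x, laplacian g x⟫) volume :=
    i1.add (i2.const_mul ν)
  unfold trajFlux
  rw [integral_add i12 i3, integral_add i1 (i2.const_mul ν), integral_const_mul]

/-- The flux splits at every time `t ≥ 0` along a global Leray–Hopf solution. [folklore] -/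
theorem trajFlux_eq_of_nonneg (hF : MemLp F 2 volume) (hu : IsGlobalLerayHopf ν (fun _ => F) u₀ u)
    {g : UnitAddTorus d → EuclideanSpace ℝ d} (hg : IsSmooth g) {t : ℝ} (ht : 0 ≤ t) :
    trajFlux ν F u g t = (∫ x, ⟪u t x, convect (u t) g x⟫) +
      ν * (∫ x, ⟪u t x, laplacian g x⟫) + ∫ x, ⟪F x, g x⟫ :=
  trajFlux_eq_of_memLp hg hF ((hu (t + 1) (by linarith)).memLp t ⟨ht, by linarith⟩)

/-- The pairing `s ↦ (u(s), a)` with a continuous field is interval integrable on `[0, T]`. [folklore] -/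
theorem intervalIntegrable_inner (hu : IsGlobalLerayHopf ν (fun _ => F) u₀ u)
    {a : UnitAddTorus d → EuclideanSpace ℝ d} (ha : Continuous a) {T : ℝ} (hT : 0 < T) :
    IntervalIntegrable (fun s => ∫ x, ⟪u s x, a x⟫) volume 0 T := by
  rw [intervalIntegrable_iff_integrableOn_Ioo_of_le hT.le]
  exact (hu T hT).integrableOn_integral_inner ha

/-- The convective pairing `s ↦ (u(s), (u(s)·∇)g)` is interval integrable on `[0, T]`. [folklore] -/
theorem intervalIntegrable_inner_convect (hF : MemLp F 2 volume)
    (hu : IsGlobalLerayHopf ν (fun _ => F) u₀ u)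
    {g : UnitAddTorus d → EuclideanSpace ℝ d} (hg : IsSmooth g) {T : ℝ} (hT : 0 < T) :
    IntervalIntegrable (fun s => ∫ x, ⟪u s x, convect (u s) g x⟫) volume 0 T := by
  rw [intervalIntegrable_iff_integrableOn_Ioo_of_le hT.le]
  have h1 : IntegrableOn (trajFlux ν F u g) (Ioo 0 T) := hu.integrableOn_trajFlux hF hg hT
  have h2 : IntegrableOn (fun s => ∫ x, ⟪u s x, laplacian g x⟫) (Ioo 0 T) :=
    (hu T hT).integrableOn_integral_inner hg.laplacian.continuous
  have h3 : IntegrableOn (fun _ : ℝ => ∫ x, ⟪F x, g x⟫) (Ioo 0 T) :=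
    integrableOn_const measure_Ioo_lt_top.ne
  refine ((h1.sub (h2.const_mul ν)).sub h3).congr_fun (fun s hs => ?_) measurableSet_Ioo
  simp only [Pi.sub_apply]
  rw [trajFlux_eq_of_nonneg hF hu hg hs.1.le]
  ring

end Pairing

/-! ### Linearity of generalized long-time averages under interval integrability -/

omit [Fintype d] [DecidableEq d] in
/-- `⟨f + g⟩_Λ = ⟨f⟩_Λ + ⟨g⟩_Λ` when `f`, `g` are interval integrable on every `[0, T]`. [folklore] -/
theorem longTimeAvg_add (Λ : GeneralizedLimit) {f g : ℝ → ℝ}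
    (hf : ∀ T, 0 < T → IntervalIntegrable f volume 0 T)
    (hg : ∀ T, 0 < T → IntervalIntegrable g volume 0 T) :
    Λ.longTimeAvg (fun t => f t + g t) = Λ.longTimeAvg f + Λ.longTimeAvg g := by
  have heq : timeMean (fun t => f t + g t) =ᶠ[atTop] (timeMean f + timeMean g) := by
    filter_upwards [eventually_gt_atTop 0] with T hT
    simp only [timeMean, Pi.add_apply]
    rw [intervalIntegral.integral_add (hf T hT) (hg T hT), mul_add]
  unfold GeneralizedLimit.longTimeAvg
  rw [Λ.apply_eq_of_eventuallyEq heq, map_add]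

omit [Fintype d] [DecidableEq d] in
/-- `⟨f - g⟩_Λ = ⟨f⟩_Λ - ⟨g⟩_Λ` when `f`, `g` are interval integrable on every `[0, T]`. [folklore] -/
theorem longTimeAvg_sub (Λ : GeneralizedLimit) {f g : ℝ → ℝ}
    (hf : ∀ T, 0 < T → IntervalIntegrable f volume 0 T)
    (hg : ∀ T, 0 < T → IntervalIntegrable g volume 0 T) :
    Λ.longTimeAvg (fun t => f t - g t) = Λ.longTimeAvg f - Λ.longTimeAvg g := by
  have heq : timeMean (fun t => f t - g t) =ᶠ[atTop] (timeMean f - timeMean g) := by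
    filter_upwards [eventually_gt_atTop 0] with T hT
    simp only [timeMean, Pi.sub_apply]
    rw [intervalIntegral.integral_sub (hf T hT) (hg T hT), mul_sub]
  unfold GeneralizedLimit.longTimeAvg
  rw [Λ.apply_eq_of_eventuallyEq heq, map_sub]

omit [Fintype d] [DecidableEq d] in
/-- `⟨c f⟩_Λ = c ⟨f⟩_Λ` (no integrability needed). [folklore] -/
theorem longTimeAvg_const_mul (Λ : GeneralizedLimit) (c : ℝ) (f : ℝ → ℝ) :
    Λ.longTimeAvg (fun t => c * f t) = c * Λ.longTimeAvg f := by
  have heq : timeMean (fun t => c * f t) = c • timeMean f := by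
    funext T
    simp only [timeMean, Pi.smul_apply, smul_eq_mul, intervalIntegral.integral_const_mul]
    ring
  unfold GeneralizedLimit.longTimeAvg
  rw [heq, map_smul, smul_eq_mul]

/-! ### Pointwise algebra of the grid design -/

omit [Fintype d] in
/-- `proj (t eᵢ) = Pi.single i t` on the torus. [folklore] -/
theorem proj_smul_single (t : ℝ) (i : d) :
    proj (t • EuclideanSpace.single i (1 : ℝ)) = Pi.single i ((t : ℝ) : UnitAddCircle) := by
  funext j
  by_cases h : j = i
  · subst h
    simp [proj]
  · simp [proj, h]

omit [Fintype d] in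
/-- A function invariant under all translations along the `i`-th coordinate circle has
`∂ᵢ f = 0`. [folklore] -/
theorem partialDeriv_eq_zero_of_forall_add_single {F' : Type*} [NormedAddCommGroup F']
    [NormedSpace ℝ F'] {f : UnitAddTorus d → F'} {i : d}
    (hinv : ∀ (s : UnitAddCircle) (x : UnitAddTorus d), f (x + Pi.single i s) = f x)
    (x : UnitAddTorus d) : Torus.partialDeriv i f x = 0 := by
  unfold Torus.partialDeriv Torus.lineDeriv
  simp_rw [proj_smul_single, hinv]
  exact deriv_const 0 (f x)

omit [DecidableEq d] in
/-- A `C¹` vector field with identically vanishing `j`-th component has derivative with vanishing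
`j`-th component. [folklore] -/
theorem fderiv_apply_coord_eq_zero {V : UnitAddTorus d → EuclideanSpace ℝ d} (hV : IsContDiff 1 V)
    {j : d} (hV0 : ∀ y, V y j = 0) (x : UnitAddTorus d) (w : EuclideanSpace ℝ d) :
    Torus.fderiv V x w j = 0 := by
  rw [← fderiv_apply_coord hV x w j]
  have h0 : (fun y => V y j) = fun _ => (0 : ℝ) := funext hV0
  rw [h0]
  have h1 : liftAt (fun _ : UnitAddTorus d => (0 : ℝ)) x = fun _ => 0 := rfl
  simp [Torus.fderiv, h1]

omit [Fintype d] [DecidableEq d] in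
/-- The convective derivative is linear in the transporting field: shifting by a constant
vector `c e`. [folklore] -/
theorem convect_sub_const_smul {F' : Type*} [NormedAddCommGroup F'] [NormedSpace ℝ F']
    (v : UnitAddTorus d → EuclideanSpace ℝ d) (V : UnitAddTorus d → F') (c : ℝ)
    (e : EuclideanSpace ℝ d) (x : UnitAddTorus d) :
    Torus.convect (fun y => v y - c • e) V x = Torus.convect v V x - c • Torus.fderiv V x e := by
  simp [Torus.convect, map_sub, map_smul]

/-- **Key pointwise algebra.** For a `C¹` field `V` with `V₍ᵢ₀₎ ≡ 0` and `∂ᵢ₀ V = θ • G` where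
`G₍ᵢ₀₎ ≡ 0`: `⟪U, (U·∇)V⟫ = ⟪W, (W·∇)V⟫ + c θ ⟪U, G⟫` with `W = U - c eᵢ₀`. [folklore] -/
theorem inner_convect_eq_shift {V G : UnitAddTorus d → EuclideanSpace ℝ d} {θ : UnitAddTorus d → ℝ}
    (hV : IsContDiff 1 V) {i₀ : d} (hV0 : ∀ y, V y i₀ = 0) (hG0 : ∀ y, G y i₀ = 0)
    (hd : ∀ y, partialDeriv i₀ V y = θ y • G y) (c : ℝ) (U : UnitAddTorus d → EuclideanSpace ℝ d)
    (x : UnitAddTorus d) :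
    ⟪U x, convect U V x⟫ =
      ⟪U x - c • EuclideanSpace.single i₀ 1,
        convect (fun y => U y - c • EuclideanSpace.single i₀ 1) V x⟫ + c * (θ x * ⟪U x, G x⟫) := by
  have hLe : Torus.fderiv V x (EuclideanSpace.single i₀ 1) = θ x • G x := by
    rw [← partialDeriv_eq_fderiv_apply hV, hd]
  have hL0 : Torus.convect U V x i₀ = 0 := fderiv_apply_coord_eq_zero hV hV0 x (U x)
  rw [convect_sub_const_smul, hLe]
  simp only [inner_sub_left, inner_sub_right, real_inner_smul_left, real_inner_smul_right,
    EuclideanSpace.inner_single_left, hL0, hG0, map_one]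
  ring

/-- The key pointwise algebra integrated over the torus on an `L²` slice. [folklore] -/
theorem integral_inner_convect_eq_shift {V G : UnitAddTorus d → EuclideanSpace ℝ d}
    {θ : UnitAddTorus d → ℝ} (hV : IsSmooth V) (hG : Continuous G) (hθ : Continuous θ)
    {i₀ : d} (hV0 : ∀ y, V y i₀ = 0) (hG0 : ∀ y, G y i₀ = 0)
    (hd : ∀ y, partialDeriv i₀ V y = θ y • G y) (c : ℝ) {U : UnitAddTorus d → EuclideanSpace ℝ d}
    (hU : MemLp U 2 volume) :
    ∫ x, ⟪U x, convect U V x⟫ =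
      (∫ x, ⟪U x - c • EuclideanSpace.single i₀ 1,
        convect (fun y => U y - c • EuclideanSpace.single i₀ 1) V x⟫) +
        c * ∫ x, θ x * ⟪U x, G x⟫ := by
  have hW : MemLp (fun y => U y - c • EuclideanSpace.single i₀ (1 : ℝ)) 2 volume :=
    hU.sub (memLp_const _)
  have i1 := integrable_inner_convect_self hW hV
  have i2 : Integrable (fun x => θ x * ⟪U x, G x⟫) volume := by
    refine (integrable_inner_of_continuous (hU.integrable one_le_two) (hθ.smul hG)).congr
      (ae_of_all _ fun x => ?_)
    show ⟪U x, θ x • G x⟫ = θ x * ⟪U x, G x⟫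
    rw [real_inner_smul_right]
  rw [← integral_const_mul, ← integral_add i1 (i2.const_mul c)]
  exact integral_congr_ae (ae_of_all _ fun x =>
    inner_convect_eq_shift (hV.isContDiff (by simp)) hV0 hG0 hd c U x)

section Design

variable {Φ Ψ : UnitAddTorus (Fin 3) → ℝ} {G : UnitAddTorus (Fin 3) → EuclideanSpace ℝ (Fin 3)}

/-- For the grid design, `Ψ • G` is divergence free: `div (Ψ G) = Ψ div G + ∇Ψ · G = 0` since
`∂₁Ψ = ∂₂Ψ = 0` and `G₀ = 0`. [folklore] -/
theorem isDivFree_smul_of_design (hΨ : IsSmooth Ψ) (hG : IsSmooth G)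
    (hΨinv : ∀ (s : UnitAddCircle) (x : UnitAddTorus (Fin 3)),
      Ψ (x + Pi.single (1 : Fin 3) s) = Ψ x ∧ Ψ (x + Pi.single (2 : Fin 3) s) = Ψ x)
    (hG0 : ∀ x, G x 0 = 0) (hdiv : IsDivFree G) : IsDivFree (fun x => Ψ x • G x) := by
  intro x
  have h1 : partialDeriv 1 Ψ x = 0 :=
    partialDeriv_eq_zero_of_forall_add_single (fun s y => (hΨinv s y).1) x
  have h2 : partialDeriv 2 Ψ x = 0 :=
    partialDeriv_eq_zero_of_forall_add_single (fun s y => (hΨinv s y).2) x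
  rw [divergence_smul (hΨ.isContDiff (by simp)) (hG.isContDiff (by simp)), hdiv x,
    Fin.sum_univ_three, hG0 x, h1, h2]
  ring

/-- For the grid design, `∂₀ (Ψ • G) = (Φ - 1) • G` (`∂₀G = 0`, `∂₀Ψ = Φ - 1`). [folklore] -/
theorem partialDeriv_zero_smul_of_design (hΨ : IsSmooth Ψ) (hG : IsSmooth G)
    (hGinv : ∀ (s : UnitAddCircle) (x : UnitAddTorus (Fin 3)), G (x + Pi.single (0 : Fin 3) s) = G x)
    (hΨ' : ∀ x, partialDeriv 0 Ψ x = Φ x - 1) (x : UnitAddTorus (Fin 3)) :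
    partialDeriv 0 (fun y => Ψ y • G y) x = (Φ x - 1) • G x := by
  rw [partialDeriv_smul (hΨ.isContDiff (by simp)) (hG.isContDiff (by simp)),
    partialDeriv_eq_zero_of_forall_add_single hGinv x, hΨ' x, smul_zero, zero_add]

end Design

end GridInjection

/-- Settles item stmt-AnomalousDissipation-1774: the route's support statement
`GridInjectionIdentity` — (1) the sawtooth identity
`c·Λ⟨(Φ•G,u)⟩ = c·Λ⟨(G,u)⟩ − Λ⟨∫⟪w,(w·∇)(Ψ•G)⟫⟩ − νΛ⟨(u,Δ(Ψ•G))⟩ − ∫ΦΨ|G|²` and (2) the pinned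
transverse stress `Λ⟨∫⟪w,(w·∇)G⟫⟩ = −∫Φ|G|² − νΛ⟨(u,ΔG)⟩`, `w = u − c e₀`, for the slab⊗transverse
force `Φ•G` and every global Leray–Hopf solution with bounded kinetic energy. Both follow from the
mean momentum balance (`GridInjection.meanMomentumBalance`, tests `Ψ•G` and `G`) by the pointwise
algebra `⟪u,(u·∇)V⟫ = ⟪w,(w·∇)V⟫ + c⟪u,∂₀V⟫` (`V₀ ≡ 0`), `∂₀(Ψ•G) = (Φ−1)•G`, `∂₀G = 0`, and
linearity of generalized long-time averages on interval-integrable functions. [folklore] -/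
theorem impulseGrid_gridInjectionIdentity :
    Summit.AnomalousDissipation.AnomalousDissipation.Theses.ImpulseGrid.GridInjectionIdentity := by
  unfold Summit.AnomalousDissipation.AnomalousDissipation.Theses.ImpulseGrid.GridInjectionIdentity
  intro Λ ν c Φ Ψ G u₀ u hν hΦ hΨ hG hΨinv hGinv hG0 hdivG hΨ' hu hE
  -- the design
  have hFs : IsSmooth (fun x => Φ x • G x) := hΦ.smul' hG
  have hF : MemLp (fun x => Φ x • G x) 2 volume := hFs.memLp 2
  have hV : IsSmooth (fun x => Ψ x • G x) := hΨ.smul' hG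
  have hVdiv : IsDivFree (fun x => Ψ x • G x) :=
    GridInjection.isDivFree_smul_of_design hΨ hG hΨinv hG0 hdivG
  have hV0 : ∀ y, (Ψ y • G y) 0 = 0 := fun y => by simp [hG0 y]
  have hdV : ∀ y, Torus.partialDeriv 0 (fun y => Ψ y • G y) y = (fun y => Φ y - 1) y • G y :=
    GridInjection.partialDeriv_zero_smul_of_design hΨ hG hGinv hΨ'
  have hdG : ∀ y, Torus.partialDeriv 0 G y = (fun _ => (0 : ℝ)) y • G y := fun y => by
    rw [zero_smul]
    exact GridInjection.partialDeriv_eq_zero_of_forall_add_single hGinv y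
  have hΦc : Continuous (fun y => Φ y - 1) := hΦ.continuous.sub continuous_const
  have hmem : ∀ t : ℝ, 0 ≤ t → MemLp (u t) 2 volume := fun t ht =>
    (hu (t + 1) (by linarith)).memLp t ⟨ht, by linarith⟩
  -- the two mean momentum balances (item stmt-AnomalousDissipation-1773)
  have hMV := meanMomentumBalance_proof Λ ν (fun x => Φ x • G x) (fun x => Ψ x • G x) u₀ u hν hFs hV
    hVdiv hu hE
  have hMG := meanMomentumBalance_proof Λ ν (fun x => Φ x • G x) G u₀ u hν hFs hG hdivG hu hE
  -- the force pairings
  have hFV : ∫ x, ⟪Φ x • G x, Ψ x • G x⟫ = ∫ x, Φ x * Ψ x * ‖G x‖ ^ 2 := by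
    refine integral_congr_ae (ae_of_all _ fun x => ?_)
    simp only [real_inner_smul_left, real_inner_smul_right, real_inner_self_eq_norm_sq]
    ring
  have hFG : ∫ x, ⟪Φ x • G x, G x⟫ = ∫ x, Φ x * ‖G x‖ ^ 2 := by
    refine integral_congr_ae (ae_of_all _ fun x => ?_)
    simp only [real_inner_smul_left, real_inner_self_eq_norm_sq]
  refine ⟨?_, ?_⟩
  · -- conjunct 1
    -- the three pieces of the convective pairing against `Ψ•G`
    have hB : ∀ T, 0 < T → IntervalIntegrable (fun t => ∫ x, ⟪Φ x • G x, u t x⟫) volume 0 T := by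
      intro T hT
      have h := GridInjection.intervalIntegrable_inner hu (hΦ.continuous.smul hG.continuous) hT
      refine (h.congr fun t _ => ?_)
      exact integral_congr_ae (ae_of_all _ fun x => real_inner_comm _ _)
    have hC : ∀ T, 0 < T → IntervalIntegrable (fun t => ∫ x, ⟪G x, u t x⟫) volume 0 T := by
      intro T hT
      have h := GridInjection.intervalIntegrable_inner hu hG.continuous hT
      refine (h.congr fun t _ => ?_)
      exact integral_congr_ae (ae_of_all _ fun x => real_inner_comm _ _)
    have hBC : ∀ T, 0 < T → IntervalIntegrable
        (fun t => c * (∫ x, ⟪Φ x • G x, u t x⟫) - c * ∫ x, ⟪G x, u t x⟫) volume 0 T :=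
      fun T hT => ((hB T hT).const_mul c).sub ((hC T hT).const_mul c)
    -- the pointwise-in-time split of the convective pairing, `t ≥ 0`
    have h1 : ∀ t : ℝ, 0 ≤ t → (∫ x, ⟪u t x, Torus.convect (u t) (fun y => Ψ y • G y) x⟫) =
        (∫ x, ⟪u t x - c • EuclideanSpace.single 0 1,
          Torus.convect (fun y => u t y - c • EuclideanSpace.single 0 1) (fun y => Ψ y • G y) x⟫) +
          (c * (∫ x, ⟪Φ x • G x, u t x⟫) - c * ∫ x, ⟪G x, u t x⟫) := by
      intro t ht
      rw [GridInjection.integral_inner_convect_eq_shift hV hG.continuous hΦc hV0 hG0 hdV c (hmem t ht)]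
      congr 1
      have hi : Integrable (u t) volume := (hmem t ht).integrable one_le_two
      have iB : Integrable (fun x => ⟪Φ x • G x, u t x⟫) volume :=
        (integrable_inner_of_continuous hi (hΦ.continuous.smul hG.continuous)).congr
          (ae_of_all _ fun x => real_inner_comm _ _)
      have iC : Integrable (fun x => ⟪G x, u t x⟫) volume :=
        (integrable_inner_of_continuous hi hG.continuous).congr
          (ae_of_all _ fun x => real_inner_comm _ _)
      have hfun : (fun x => (Φ x - 1) * ⟪u t x, G x⟫) = fun x => ⟪Φ x • G x, u t x⟫ - ⟪G x, u t x⟫ := by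
        funext x
        rw [real_inner_smul_left, real_inner_comm (G x) (u t x)]
        ring
      rw [hfun, integral_sub iB iC, mul_sub]
    -- interval integrability of the shifted convective pairing
    have hA : ∀ T, 0 < T → IntervalIntegrable (fun t => ∫ x, ⟪u t x - c • EuclideanSpace.single 0 1,
        Torus.convect (fun y => u t y - c • EuclideanSpace.single 0 1) (fun y => Ψ y • G y) x⟫)
        volume 0 T := by
      intro T hT
      have h := (GridInjection.intervalIntegrable_inner_convect hF hu hV hT).sub (hBC T hT)
      refine h.congr fun t ht => ?_
      rw [uIoc_of_le hT.le] at ht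
      show (∫ x, ⟪u t x, Torus.convect (u t) (fun y => Ψ y • G y) x⟫) -
        (c * (∫ x, ⟪Φ x • G x, u t x⟫) - c * ∫ x, ⟪G x, u t x⟫) = _
      rw [h1 t ht.1.le]
      ring
    -- linearity of the generalized long-time average
    have hsplit : Λ.longTimeAvg (fun t => ∫ x, ⟪u t x, Torus.convect (u t) (fun y => Ψ y • G y) x⟫) =
        Λ.longTimeAvg (fun t => ∫ x, ⟪u t x - c • EuclideanSpace.single 0 1,
          Torus.convect (fun y => u t y - c • EuclideanSpace.single 0 1) (fun y => Ψ y • G y) x⟫) +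
          (c * Λ.longTimeAvg (fun t => ∫ x, ⟪Φ x • G x, u t x⟫) -
            c * Λ.longTimeAvg (fun t => ∫ x, ⟪G x, u t x⟫)) := by
      rw [Λ.longTimeAvg_congr (fun t ht => h1 t ht.le), GridInjection.longTimeAvg_add Λ hA hBC,
        GridInjection.longTimeAvg_sub Λ (fun T hT => (hB T hT).const_mul c)
          (fun T hT => (hC T hT).const_mul c),
        GridInjection.longTimeAvg_const_mul, GridInjection.longTimeAvg_const_mul]
    rw [hsplit, hFV] at hMV
    linarith
  · -- conjunct 2: the shifted convective pairing against `G` is the unshifted one for `t > 0`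
    have h2 : ∀ t : ℝ, 0 < t →
        (∫ x, ⟪u t x - c • EuclideanSpace.single 0 1,
          Torus.convect (fun y => u t y - c • EuclideanSpace.single 0 1) G x⟫) =
          ∫ x, ⟪u t x, Torus.convect (u t) G x⟫ := by
      intro t ht
      rw [GridInjection.integral_inner_convect_eq_shift hG hG.continuous continuous_const hG0 hG0
        hdG c (hmem t ht.le)]
      simp
    rw [Λ.longTimeAvg_congr h2, ← hFG]
    linarith

end Summit.AnomalousDissipation.AnomalousDissipation.Theorems

end
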